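import Summits.Ventures.HodgeRepro2.T5RecordJointNine
import Summits.Ventures.HodgeRepro2.T5CyclotomicSubfieldInfinitude
import Summits.Ventures.HodgeRepro2.T5CyclotomicSubfieldHeckeInfinitude
import Summits.Ventures.HodgeRepro2.T5RecordJointPredicate

/-!
# Joint consistency on EVERY CM subfield of EVERY cyclotomic field, at infinitely many (degree-one) places

Tier-5 support N3 / §G-N4.2 (seat p3, gen 88). Files 360 / 361 / 364 / 368 count the places of the record's example
fields at which the joint statement of file 356 holds. This file does it ONCE for every CM subfield `F` of every
cyclotomic field `ℚ(ζ_m)` (by Kronecker–Weber — census only, not in the tree — every abelian CM field): the primes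
`p ≡ −1 (mod m)` are infinite (file 296's `infinite_setOf_prime_eq_neg_one_mod`), unramified in `F`
(`T5CyclotomicUnramified.ramificationIdx_eq_one`), and every place of `F⁺` above them is a DEGREE-ONE place that
stays prime in `F` (`f(𝔭/p) = 2`, `f(v/p) = 1`, `N(v) = p`; file 296's `exists_map_eq_of_eq_neg_one_mod`); the record's
`T5CyclotomicSubfieldHeckeInfinitude` indexes such places (`vNegOf`, injective, `exists_map_eq_vNegOf`,
`coprime_of_eq_neg_one_mod`) — all REUSED here. Hence:

* **`discr_subfield_notMem`** — `disc F ∉ v` for every place `v` of `F⁺` above `p ∤ m` (file 362; 363's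
  `discr_fixedField_notMem` is the case `m = 21`, `F = ℚ(ζ₂₁)^{⟨σ₁₃⟩}`);
* **`joint_subfield_of_eq_neg_one_mod`** — at every place `v` of `F⁺` under a prime `𝔭 ∣ p` of `F` with
  `p ≡ −1 (mod m)`: `∃ w, v 𝓞_F = w` and `Joint F (vRat p) v w hmap k` (file 371's name for file 356's conclusion: the
  lattice-model data for `diag(1, 1, −1)` at `v` over `vRat p` AND the unramified spectrum of the record's pair at `v`,
  Satake parameter `α · N(v)⁻² = α · p⁻²`);
* `absNorm_of_eq_neg_one_mod` — `N(v) = p` at these places;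
* **`infinite_setOf_joint_subfield`** — the set of places `v` of `F⁺` above a prime `p ≡ −1 (mod m)`, staying prime,
  at which `Joint F (vRat p) v w hmap k` holds, is INFINITE (the record's places `vNegOf m L F p`, injective in `p`,
  with `exists_map_eq_vNegOf`).

The statements are written on file 371's `Joint` (re-elaborating file 356's 70-line conclusion on a variable subfield
exceeded the farm's wall — annex §103); `Joint` unfolds (it is an `abbrev`) to that conclusion verbatim.

Nothing is claimed at the primes dividing `m`. §8(d): uses an L-value-free non-vanishing device: NO.
-/
open Matrix NumberField NumberField.IsCMField IsDedekindDomain IsDedekindDomain.HeightOneSpectrum Module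
  MulAction
open scoped TensorProduct Pointwise
open Summit.Ventures.HodgeRepro2.T5UnitaryGroupForm Summit.Ventures.HodgeRepro2.T5UnitaryHeckeAdjoint
  Summit.Ventures.HodgeRepro2.T5HeckePermutationModule Summit.Ventures.HodgeRepro2.LevelPositivity
  Summit.Ventures.HodgeRepro2.T5LevelIdempotent Summit.Ventures.HodgeRepro2.T5StarOfInvolution
  Summit.Ventures.HodgeRepro2.T5FinitePlaceCM Summit.Ventures.HodgeRepro2.T5NonSplitPlaceUnitaryGroup
  Summit.Ventures.HodgeRepro2.T5RecordHyperspecial Summit.Ventures.HodgeRepro2.T5GlobalLatticeAlmostAll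
  Summit.Ventures.HodgeRepro2.T5HermitianThreeElements Summit.Ventures.HodgeRepro2.T5GaloisCartanThree
  Summit.Ventures.HodgeRepro2.T5InertDegreeGalois Summit.Ventures.HodgeRepro2.T5InertPlaceCompletion
  Summit.Ventures.HodgeRepro2.T5InertDegreeAdicCompletion Summit.Ventures.HodgeRepro2.T5InertSatakeTransform
  Summit.Ventures.HodgeRepro2.T5InertSatakeTransformCompletion Summit.Ventures.HodgeRepro2.T5InertUnipotentResidue
  Summit.Ventures.HodgeRepro2.T5InertSphericalSubquotient Summit.Ventures.HodgeRepro2.T5RecordSatakeCell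
  Summit.Ventures.HodgeRepro2.T5SplitPlaceUnitaryGroup Summit.Ventures.HodgeRepro2.T5FinitePlaceNormIndex
  Summit.Ventures.HodgeRepro2.T5HermitianLocalIsotropyN3 Summit.Ventures.HodgeRepro2.T5FinitePlaceSplitClassification
  Summit.Ventures.HodgeRepro2.T5InertDegreeCompletion Summit.Ventures.HodgeRepro2.T5InertPlaceCompletionCells
  Summit.Ventures.HodgeRepro2.T5RecordSatake Summit.Ventures.HodgeRepro2.T5CartanCellsDistinct
  Summit.Ventures.HodgeRepro2.T5RecordSatakeInert Summit.Ventures.HodgeRepro2.T5InertGlobalPrime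
  Summit.Ventures.HodgeRepro2.T5CMFieldSquareDatum Summit.Ventures.HodgeRepro2.T5RecordSatakeDegree
  Summit.Ventures.HodgeRepro2.T5RecordSatakeDegreeIntrinsic Summit.Ventures.HodgeRepro2.T5RecordSphericalSpectrum
  Summit.Ventures.HodgeRepro2.T5RecordSphericalSpectrumIntrinsic Summit.Ventures.HodgeRepro2.T5RecordSatakeToy
  Summit.Ventures.HodgeRepro2.T5RecordSphericalSpectrumDatumFree
  Summit.Ventures.HodgeRepro2.T5AdditiveConductor Summit.Ventures.HodgeRepro2.T5UnitaryGroupIsometry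
  Summit.Ventures.HodgeRepro2.T5ConductorDualLattice Summit.Ventures.HodgeRepro2.T5ConductorDualLatticeSplit
  Summit.Ventures.HodgeRepro2.T5SplitHermitianClass Summit.Ventures.HodgeRepro2.T5RecordLatticeModelOutsideDiscriminant
  Summit.Ventures.HodgeRepro2.T5RecordLatticeModelSeven Summit.Ventures.HodgeRepro2.T5RecordJointOutsideDiscriminant
  Summit.Ventures.HodgeRepro2.T5RationalPlace Summit.Ventures.HodgeRepro2.T5DiscriminantUnramified
  Summit.Ventures.HodgeRepro2.T5CyclotomicSevenHeckeCommutative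
  Summit.Ventures.HodgeRepro2.T5CyclotomicSevenSplitPrime Summit.Ventures.HodgeRepro2.T5RecordJointNine
  Summit.Ventures.HodgeRepro2.T5CyclotomicSubfieldInfinitude Summit.Ventures.HodgeRepro2.T5CyclotomicInfinitelyManyPlaces
  Summit.Ventures.HodgeRepro2.T5CyclotomicSubfieldHeckeInfinitude Summit.Ventures.HodgeRepro2.T5RecordJointPredicate

namespace Summit.Ventures.HodgeRepro2.T5RecordJointCyclotomicSubfield

universe uV

variable (m : ℕ) [NeZero m] (L : Type*) [Field L] [NumberField L] [IsCyclotomicExtension {m} ℚ L] [IsCMField L]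
variable (F : IntermediateField ℚ L) [IsCMField F]
variable (p : ℕ) [hp : Fact p.Prime]
variable (k : Type*) [Field k] [CharZero k] [IsAlgClosed k]

omit [IsCMField L] [IsCMField F] in
/-- **`disc F ∉ v` for every place `v` of `F⁺` above a prime `p ∤ m`** (file 362 with the record's unramifiedness of
the subfields of `ℚ(ζ_m)` at `p ∤ m`). -/
theorem discr_subfield_notMem (hpm : ¬ p ∣ m) (v : HeightOneSpectrum (𝓞 (maximalRealSubfield F)))
    [hv : v.asIdeal.LiesOver (Ideal.span {(p : ℤ)})] :
    ((discr F : ℤ) : 𝓞 (maximalRealSubfield F)) ∉ v.asIdeal :=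
  discr_notMem_of_forall_ramificationIdx_eq_one F p
    (fun w hw =>
      haveI := liesOver_int_of_mem p w hw
      T5CyclotomicUnramified.ramificationIdx_eq_one (m := m) p L F hpm w.asIdeal) v

/-- **JOINT CONSISTENCY ON EVERY CM SUBFIELD OF `ℚ(ζ_m)` AT EVERY PLACE ABOVE EVERY PRIME `p ≡ −1 (mod m)`** (file 356
at `vp = vRat p`; the place `w` from file 296: `f(𝔭/p) = 2`, `f(v/p) = 1`). -/
theorem joint_subfield_of_eq_neg_one_mod (𝔭 : Ideal (𝓞 F)) [𝔭.IsPrime] [𝔭.LiesOver (Ideal.span {(p : ℤ)})]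
    (v : HeightOneSpectrum (𝓞 (maximalRealSubfield F))) [𝔭.LiesOver v.asIdeal] (hneg : (p : ZMod m) = -1) :
    letI : v.asIdeal.LiesOver (vRat p).asIdeal := liesOver_vRat_of_mem p v (natCast_mem_of_liesOver_of_liesOver F p 𝔭 v)
    ∃ (w : HeightOneSpectrum (𝓞 F))
      (hmap : Ideal.map (algebraMap (𝓞 (maximalRealSubfield F)) (𝓞 F)) v.asIdeal = w.asIdeal),
      letI := liesOver_of_map_eq F v w hmap
      Joint.{uV, _, _} F (vRat p) v w hmap k :=
  have hpm : p.Coprime m := coprime_of_eq_neg_one_mod m p hneg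
  (exists_map_eq_of_eq_neg_one_mod m L F p hpm 𝔭 v hneg).2.2.elim fun w hmap =>
    ⟨w, hmap, @joint_of_staysPrime F _ _ _ (vRat p) v
      (liesOver_vRat_of_mem p v (natCast_mem_of_liesOver_of_liesOver F p 𝔭 v)) w (liesOver_of_map_eq F v w hmap) hmap k _ _ _
      (discr_subfield_notMem m L F p ((Nat.Prime.coprime_iff_not_dvd hp.out).mp hpm) v
        (hv := liesOver_int_of_mem p v (natCast_mem_of_liesOver_of_liesOver F p 𝔭 v)))⟩

/-- **`N(v) = p`** at every place `v` of `F⁺` under a prime `𝔭 ∣ p` of `F` with `p ≡ −1 (mod m)` (a degree-one place;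
file 296's `f(v/p) = 1`). -/
theorem absNorm_of_eq_neg_one_mod (𝔭 : Ideal (𝓞 F)) [𝔭.IsPrime] [𝔭.LiesOver (Ideal.span {(p : ℤ)})]
    (v : HeightOneSpectrum (𝓞 (maximalRealSubfield F))) [𝔭.LiesOver v.asIdeal] (hneg : (p : ZMod m) = -1) :
    Ideal.absNorm v.asIdeal = p := by
  haveI := liesOver_int_of_mem p v (natCast_mem_of_liesOver_of_liesOver F p 𝔭 v)
  rw [← Ideal.pow_inertiaDeg p v.asIdeal,
    (exists_map_eq_of_eq_neg_one_mod m L F p (coprime_of_eq_neg_one_mod m p hneg) 𝔭 v hneg).2.1, pow_one]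

/-- **AT INFINITELY MANY PLACES OF `F⁺` THE JOINT STATEMENT HOLDS, FOR EVERY CM SUBFIELD `F` OF `ℚ(ζ_m)`**: the set of
places `v` above a prime `p ≡ −1 (mod m)`, staying prime (`v 𝓞_F = w`), at which the lattice-model data for
`diag(1, 1, −1)` over `vRat p` AND the unramified spectrum of the record's pair (Satake parameter `α · p⁻²`) hold, is
infinite. -/
theorem infinite_setOf_joint_subfield :
    {v : HeightOneSpectrum (𝓞 (maximalRealSubfield F)) |
      ∃ (p : ℕ) (hp : Fact p.Prime) (_hneg : (p : ZMod m) = -1) (hmem : (p : 𝓞 (maximalRealSubfield F)) ∈ v.asIdeal),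
        letI : v.asIdeal.LiesOver (@vRat p hp).asIdeal := @liesOver_vRat_of_mem p hp _ _ _ v hmem
        ∃ (w : HeightOneSpectrum (𝓞 F))
          (hmap : Ideal.map (algebraMap (𝓞 (maximalRealSubfield F)) (𝓞 F)) v.asIdeal = w.asIdeal),
          letI := liesOver_of_map_eq F v w hmap
          Joint.{uV, _, _} F (@vRat p hp) v w hmap k}.Infinite := by
  haveI : Infinite {p : ℕ // p.Prime ∧ (p : ZMod m) = -1} := (infinite_setOf_prime_eq_neg_one_mod m).to_subtype
  refine Set.infinite_of_injective_forall_mem (vNegOf_injective m L F) fun p => ?_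
  haveI hp : Fact p.1.Prime := ⟨p.2.1⟩
  haveI := liesOver_vNegOf m L F p
  have hmem : (p.1 : 𝓞 (maximalRealSubfield F)) ∈ (vNegOf m L F p).asIdeal :=
    natCast_mem_of_liesOver (maximalRealSubfield F) p.1 (vNegOf m L F p).asIdeal
  obtain ⟨w, hmap⟩ := exists_map_eq_vNegOf m L F p
  refine ⟨p.1, hp, p.2.2, hmem, w, hmap, ?_⟩
  with_reducible
    exact @joint_of_staysPrime F _ _ _ (@vRat p.1 hp) (vNegOf m L F p)
      (@liesOver_vRat_of_mem p.1 hp _ _ _ (vNegOf m L F p) hmem) w (liesOver_of_map_eq F (vNegOf m L F p) w hmap)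
      hmap k _ _ _
      (discr_subfield_notMem m L F p.1 ((Nat.Prime.coprime_iff_not_dvd p.2.1).mp (coprime_of_eq_neg_one_mod m p.1 p.2.2))
        (vNegOf m L F p) (hv := liesOver_int_of_mem p.1 (vNegOf m L F p) hmem))

end Summit.Ventures.HodgeRepro2.T5RecordJointCyclotomicSubfield
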